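import Literature.Analysis.ODE.HeunDerivative
import HarnessLib

/-!
# Euler's integral transformation of Heun's equation: the kernel identity
# (Kazakov–Slavyanov; Takemura, Prop. 1.2)

Topic `Literature/Analysis/ODE` (namespace `Literature.Analysis.ODE`, grouping sub-namespace
`GeneralHeun`, continuing `HeunDerivative.lean`: Umetsu's normalisation
`M_z(γ,δ,ε;α,β;q) = z(z−1)(z−a_H)∂² + [γ(z−1)(z−a_H) + δ z(z−a_H) + ε z(z−1)]∂ + αβ z + q`,
accessory parameter with sign `+q`).

K. Takemura, *Integral transformation of Heun's equation and some applications*, J. Math. Soc.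
Japan 69 (2017) 849–891 [Takemura2017], Proposition 1.2 (attributed there to Kazakov–Slavyanov
and to Takemura's middle-convolution paper): "Set `(η−α)(η−β) = 0`, `ε₀' = ε₀−η+1`,
`ε₁' = ε₁−η+1`, `ε_t' = ε_t−η+1`, `{α',β'} = {2−η, α+β−2η+1}`,
`q' = q + (1−η)(ε_t + ε₁ t + (ε₀−η)(t+1))`. Let `v(w)` be a solution of
`v'' + (ε₀'/w + ε₁'/(w−1) + ε_t'/(w−t)) v' + (α'β' w − q')/(w(w−1)(w−t)) v = 0`. Then the function
`y(z) = ∫_{[γ_z,γ_p]} v(w)(z−w)^{−η} dw` is a solution of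
`y'' + (ε₀/z + ε₁/(z−1) + ε_t/(z−t)) y' + (αβ z − q)/(z(z−1)(z−t)) y = 0` for `p ∈ {0,1,t,∞}`."
(Takemura's `(ε₀, ε₁, ε_t, t, q)` are Umetsu's `(γ, δ, ε, a_H, −q)`.)

What is PROVED here is the algebraic heart of that proposition, in the form an
integration-by-parts argument consumes — no contour, no convergence question:

* `GeneralHeun.euler_kernel_identity`: for the Euler kernel `K(x,y) = k(x−y)` with
  `(x−y) k' = −η k`, `(x−y)² k'' = η(η+1) k` (i.e. `k(u) ∝ u^{−η}`), the TARGET operator in `x`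
  applied to `K` equals the formal (Lagrange) ADJOINT of the SOURCE operator in `y` applied to `K`:
  `M_x(γ,δ,ε;α,β;q) K = M_y(γ',δ',ε';α',β';q')† K`, under the Fuchs relation and `(η−α)(η−β) = 0`
  (`GeneralHeun.adjointApply` is `M† v = (lead·v)'' − (mid·v)' + low·v` written out);
* `GeneralHeun.lagrange_identity`: `v·(M u) − u·(M† v) = d/dy[lead·(v u' − u v') + (mid − lead')·u v]`
  (so `∫ K · (M v) = ∫ (M† K) · v +` boundary terms);
* `GeneralHeun.eulerKernel η u = exp(−η log u)` (`= u^{−η}`, `u > 0`) with its two derivative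
  relations, and the identity instantiated on it (`euler_kernel_identity_pow`, real `x > y`);
* bookkeeping: the source parameters satisfy the Fuchs relation (`euler_fuchs`), and the map is an
  involution with exponent `2−η` (`eulerSrc_eulerSrc`, …; Takemura's remark after Prop. 1.2).

Motivation (recorded, not used): for the Kerr–de Sitter radial Teukolsky equation in the
normalisation of Casals–Teixeira da Costa (arXiv:2105.13329, (3.11) with masses `m₁,…,m₄`), the
gauge `(γ,δ,ε) = (1−m₁+m₂, 1+m₁+m₂, 1−m₃−m₄)`, `{α,β} = {1+m₂−m₃, 1+m₂−m₄}` has `η = α = 1+m₂−m₃`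
sending `(γ,δ,ε,α,β,q)` EXACTLY to the `m₂ ↔ m₃`-swapped parameters (their "hidden symmetry",
Cor. 3.9); that specialisation lives in a Kerr–de Sitter file. NOT here: any statement about
integrals, contours or solutions of boundary-value problems. No named facts are introduced.

## References
* K. Takemura, J. Math. Soc. Japan 69 (2017) 849–891, arXiv:1008.4007, Prop. 1.2. Key `Takemura2017`.
* A. Ya. Kazakov, S. Yu. Slavyanov, *Euler integral symmetries for a deformed Heun equation and
  symmetries of the Painlevé PVI equation*, Theor. Math. Phys. 155 (2008) 722–733 (cited via
  [Takemura2017]).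
* H. Umetsu, Prog. Theor. Phys. 104 (2000) 743–755, §3 (normalisation). Key `Umetsu2000`.
* E. L. Ince, *Ordinary Differential Equations* (1926), §5.3 (adjoint operator, Lagrange identity).
  Key `Ince1926`.
-/

noncomputable section

open Set Filter
open scoped Topology

namespace Literature.Analysis.ODE

namespace GeneralHeun

/-! ### Takemura's parameter map (Umetsu's sign of the accessory parameter) -/

/-- Source value of one of the three finite exponent parameters under Euler's transformation with
exponent `η`: `γ' = γ − η + 1` (likewise `δ' = δ − η + 1`, `ε' = ε − η + 1`).
[cite: Takemura2017, Proposition 1.2] -/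
def eulerSrc (p η : ℂ) : ℂ := p - η + 1

/-- Source `α' = 2 − η`. [cite: Takemura2017, Proposition 1.2] -/
def eulerSrcα (η : ℂ) : ℂ := 2 - η

/-- Source `β' = α + β − 2η + 1`. [cite: Takemura2017, Proposition 1.2] -/
def eulerSrcβ (α β η : ℂ) : ℂ := α + β - 2 * η + 1

/-- Source accessory parameter in Umetsu's sign convention (`low = αβ z + q`; Takemura's `q` is
`−q` here): `q' = q − (1−η)(ε + δ a_H + (γ−η)(a_H+1))`. [cite: Takemura2017, Proposition 1.2] -/
def eulerSrcQ (aH γ δ ε q η : ℂ) : ℂ :=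
  q - (1 - η) * (ε + δ * aH + (γ - η) * (aH + 1))

/-- The source parameters inherit the Fuchs relation `γ'+δ'+ε' = α'+β'+1`.
[cite: Takemura2017, Proposition 1.2] -/
theorem euler_fuchs {α β γ δ ε : ℂ} (η : ℂ) (hF : γ + δ + ε = α + β + 1) :
    eulerSrc γ η + eulerSrc δ η + eulerSrc ε η = eulerSrcα η + eulerSrcβ α β η + 1 := by
  unfold eulerSrc eulerSrcα eulerSrcβ
  linear_combination hF

/-- `2 − η` is a root of the source exponent pair: `(η'−α')(η'−β') = 0` with `η' = 2−η`, so the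
transformation can be applied backwards with exponent `2 − η`.
[cite: Takemura2017, remark after Proposition 1.2] -/
theorem eulerSrc_root (α β η : ℂ) :
    ((2 - η) - eulerSrcα η) * ((2 - η) - eulerSrcβ α β η) = 0 := by
  unfold eulerSrcα
  ring

/-- Involution: applying the map with exponent `2−η` to the source finite parameters returns the
target ones. [cite: Takemura2017, remark after Proposition 1.2] -/
theorem eulerSrc_eulerSrc (p η : ℂ) : eulerSrc (eulerSrc p η) (2 - η) = p := by
  unfold eulerSrc
  ring

/-- Involution for `α`: with `η = α`, `{α'', β''} ∋ α`, namely `β-slot` value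
`α' + β' − 2(2−η) + 1 = β` and `2 − (2−η) = η = α`. [cite: Takemura2017, remark after Proposition 1.2] -/
theorem eulerSrcβ_eulerSrc (α β η : ℂ) :
    eulerSrcβ (eulerSrcα η) (eulerSrcβ α β η) (2 - η) = α + β - η := by
  unfold eulerSrcα eulerSrcβ
  ring

/-- Involution for `α`-slot: `2 − (2 − η) = η`. [cite: Takemura2017, remark after Proposition 1.2] -/
theorem eulerSrcα_two_sub (η : ℂ) : eulerSrcα (2 - η) = η := by
  unfold eulerSrcα
  ring

/-- Involution for the accessory parameter. [cite: Takemura2017, remark after Proposition 1.2] -/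
theorem eulerSrcQ_eulerSrcQ (aH γ δ ε q η : ℂ) :
    eulerSrcQ aH (eulerSrc γ η) (eulerSrc δ η) (eulerSrc ε η) (eulerSrcQ aH γ δ ε q η) (2 - η)
      = q := by
  unfold eulerSrcQ eulerSrc
  ring

/-! ### The formal adjoint and the Lagrange identity -/

/-- The formal (Lagrange) adjoint `M† = ∂²∘lead − ∂∘mid + low` of Umetsu's operator
`M = lead ∂² + mid ∂ + low`, applied at `y` to a function with value `v` and first/second
derivatives `v₁`, `v₂` there:
`M† v = (lead v)'' − (mid v)' + low v = lead v₂ + (2 lead' − mid) v₁ + (lead'' − mid' + low) v`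
(`lead' = mid a_H 1 1 1`, `lead'' = midDeriv a_H 1 1 1`). [cite: Ince1926, §5.3 (adjoint expression)] -/
def adjointApply (aH α β γ δ ε q : ℂ) (y : ℝ) (v v₁ v₂ : ℂ) : ℂ :=
  lead aH y * v₂ + (2 * mid aH 1 1 1 y - mid aH γ δ ε y) * v₁ +
    (midDeriv aH 1 1 1 y - midDeriv aH γ δ ε y + low α β q y) * v

/-- `d/dz lead' = lead'' = midDeriv a_H 1 1 1`. [cite: Umetsu2000, §3 (3.1)–(3.2)] -/
theorem hasDerivAt_leadDeriv (aH : ℂ) (x : ℝ) :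
    HasDerivAt (mid aH 1 1 1) (midDeriv aH 1 1 1 x) x :=
  hasDerivAt_mid aH 1 1 1 x

/-- **Lagrange identity** for Umetsu's Heun operator: if `u`, `v` are twice differentiable at `y`
(derivatives `u₁,u₂`, `v₁,v₂`), then the bilinear concomitant
`B(y) = lead·(v u₁ − u v₁) + (mid − lead')·(u v)` has derivative `v·(M u) − u·(M† v)` at `y`.
This is what turns `∫ K·(M v)` into `∫ (M† K)·v` plus boundary terms (Lagrange's identity
`v L(u) − u L̄(v) = d/dx[bilinear concomitant]` for the second-order operator `M`).
[cite: Ince1926, §5.3 (Lagrange identity)] -/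
theorem lagrange_identity {aH α β γ δ ε q : ℂ} {u u₁ u₂ v v₁ v₂ : ℝ → ℂ} {y : ℝ}
    (hu : HasDerivAt u (u₁ y) y) (hu₁ : HasDerivAt u₁ (u₂ y) y)
    (hv : HasDerivAt v (v₁ y) y) (hv₁ : HasDerivAt v₁ (v₂ y) y) :
    HasDerivAt (fun t => lead aH t * (v t * u₁ t - u t * v₁ t) +
        (mid aH γ δ ε t - mid aH 1 1 1 t) * (u t * v t))
      (v y * (lead aH y * u₂ y + mid aH γ δ ε y * u₁ y + low α β q y * u y) -
        u y * adjointApply aH α β γ δ ε q y (v y) (v₁ y) (v₂ y)) y := by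
  have hL := hasDerivAt_lead aH y
  have hM := hasDerivAt_mid aH γ δ ε y
  have hL' := hasDerivAt_leadDeriv aH y
  have h := (hL.mul ((hv.mul hu₁).sub (hu.mul hv₁))).add ((hM.sub hL').mul (hu.mul hv))
  refine h.congr_deriv ?_
  unfold adjointApply low
  simp only [Pi.mul_apply, Pi.sub_apply]
  ring

/-! ### The kernel identity -/

/-- **Euler kernel identity (Kazakov–Slavyanov / Takemura Prop. 1.2, algebraic form).**
Let the Heun parameters satisfy the Fuchs relation `γ+δ+ε = α+β+1` and let `η` be one of the
exponents at infinity, `(η−α)(η−β) = 0`. Let `x ≠ y` be real and let `K, K₁, K₂ ∈ ℂ` be the value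
and the first two `x`-derivatives at `(x,y)` of a kernel `K(x,y) = k(x−y)` with
`(x−y)·K₁ = −η K` and `(x−y)²·K₂ = η(η+1) K` (so `∂_y K = −K₁`, `∂_y² K = K₂`; e.g.
`k(u) = u^{−η}`). Then the target operator in `x` applied to `K` equals the adjoint of the source
operator (parameters `eulerSrc γ η, eulerSrc δ η, eulerSrc ε η; eulerSrcα η, eulerSrcβ α β η;
eulerSrcQ`) in `y` applied to `K`:
`lead(x) K₂ + mid_{γδε}(x) K₁ + (αβ x + q) K = M'†_y K`.
[cite: Takemura2017, Proposition 1.2] -/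
theorem euler_kernel_identity {aH α β γ δ ε q η : ℂ} (hF : γ + δ + ε = α + β + 1)
    (hη : (η - α) * (η - β) = 0) {x y : ℝ} (hxy : x ≠ y) {K K₁ K₂ : ℂ}
    (hK₁ : ((x : ℂ) - y) * K₁ = -η * K) (hK₂ : ((x : ℂ) - y) ^ 2 * K₂ = η * (η + 1) * K) :
    lead aH x * K₂ + mid aH γ δ ε x * K₁ + low α β q x * K =
      adjointApply aH (eulerSrcα η) (eulerSrcβ α β η) (eulerSrc γ η) (eulerSrc δ η)
        (eulerSrc ε η) (eulerSrcQ aH γ δ ε q η) y K (-K₁) K₂ := by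
  have hu : ((x : ℂ) - (y : ℂ)) ≠ 0 := sub_ne_zero.mpr (by exact_mod_cast hxy)
  have hK₁' : K₁ = -η * K / ((x : ℂ) - y) := by
    rw [eq_div_iff hu]; linear_combination hK₁
  have hK₂' : K₂ = η * (η + 1) * K / ((x : ℂ) - y) ^ 2 := by
    rw [eq_div_iff (pow_ne_zero 2 hu)]; linear_combination hK₂
  have hβ : β = γ + δ + ε - 1 - α := by linear_combination -hF
  subst hβ
  rcases mul_eq_zero.mp hη with h | h
  · have hηα : η = α := sub_eq_zero.mp h
    subst hηα
    rw [hK₁', hK₂']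
    unfold adjointApply eulerSrc eulerSrcα eulerSrcβ eulerSrcQ lead mid midDeriv low
    field_simp
    ring
  · have hηβ : η = γ + δ + ε - 1 - α := sub_eq_zero.mp h
    subst hηβ
    rw [hK₁', hK₂']
    unfold adjointApply eulerSrc eulerSrcα eulerSrcβ eulerSrcQ lead mid midDeriv low
    field_simp
    ring

/-! ### The power kernel `u^{−η}` on `u > 0` -/

/-- The Euler kernel profile `k_η(u) = exp(−η log u)` (`= u^{−η}` for `u > 0`, principal branch),
as a function of a real variable (junk but harmless values for `u ≤ 0`, where `Real.log` is used
formally). [cite: Takemura2017, Proposition 1.2] -/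
def eulerKernel (η : ℂ) (u : ℝ) : ℂ :=
  Complex.exp (-η * (Real.log u : ℂ))

/-- For `u > 0`, `k_η(u) = u^{−η}` (complex power of the positive real `u`).
[cite: Takemura2017, Proposition 1.2] -/
theorem eulerKernel_eq_cpow (η : ℂ) {u : ℝ} (hu : 0 < u) :
    eulerKernel η u = (u : ℂ) ^ (-η) := by
  unfold eulerKernel
  rw [Complex.cpow_def_of_ne_zero (by exact_mod_cast hu.ne'), Complex.ofReal_log hu.le]
  ring_nf

/-- The kernel profile `k_η = exp(−η log u)` never vanishes. [cite: Takemura2017, Proposition 1.2 (kernel)] -/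
theorem eulerKernel_ne_zero (η : ℂ) (u : ℝ) : eulerKernel η u ≠ 0 :=
  Complex.exp_ne_zero _

/-- Index shift: `u · k_{η+1}(u) = k_η(u)` for `u > 0` (`u · u^{−η−1} = u^{−η}`).
[cite: Takemura2017, Proposition 1.2] -/
theorem mul_eulerKernel_succ (η : ℂ) {u : ℝ} (hu : 0 < u) :
    (u : ℂ) * eulerKernel (η + 1) u = eulerKernel η u := by
  unfold eulerKernel
  have hexp : Complex.exp ((Real.log u : ℂ)) = (u : ℂ) := by
    rw [← Complex.ofReal_exp, Real.exp_log hu]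
  have h : -(η + 1) * (Real.log u : ℂ) = -η * (Real.log u : ℂ) - (Real.log u : ℂ) := by ring
  have hu' : (u : ℂ) ≠ 0 := by exact_mod_cast hu.ne'
  rw [h, Complex.exp_sub, hexp]
  field_simp

/-- Derivative of the kernel profile: `k_η'(u) = −η k_{η+1}(u)` for `u > 0`
(`d/du u^{−η} = −η u^{−η−1}`). [cite: Takemura2017, Proposition 1.2] -/
theorem hasDerivAt_eulerKernel (η : ℂ) {u : ℝ} (hu : 0 < u) :
    HasDerivAt (eulerKernel η) (-η * eulerKernel (η + 1) u) u := by
  have h1 : HasDerivAt (fun t : ℝ => (Real.log t : ℂ)) ((u⁻¹ : ℝ) : ℂ) u :=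
    (Real.hasDerivAt_log hu.ne').ofReal_comp
  have h2 : HasDerivAt (eulerKernel η)
      (Complex.exp (-η * (Real.log u : ℂ)) * (-η * ((u⁻¹ : ℝ) : ℂ))) u := by
    unfold eulerKernel
    exact (h1.const_mul (-η)).cexp
  refine h2.congr_deriv ?_
  have hu' : (u : ℂ) ≠ 0 := by exact_mod_cast hu.ne'
  have hs := mul_eulerKernel_succ η hu
  have hk1 : eulerKernel (η + 1) u = eulerKernel η u * (u : ℂ)⁻¹ := by
    rw [← hs]
    field_simp
  rw [hk1]
  unfold eulerKernel
  push_cast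
  ring

/-- The kernel `K(x,y) = k_η(x−y)` as a function of `x` (`x > y`): `∂_x K = −η k_{η+1}(x−y)`.
[cite: Takemura2017, Proposition 1.2] -/
theorem hasDerivAt_eulerKernel_left (η : ℂ) {x y : ℝ} (hxy : y < x) :
    HasDerivAt (fun t : ℝ => eulerKernel η (t - y)) (-η * eulerKernel (η + 1) (x - y)) x := by
  exact (hasDerivAt_eulerKernel η (sub_pos.mpr hxy)).comp_sub_const x y

/-- The kernel `K(x,y) = k_η(x−y)` as a function of `y` (`y < x`): `∂_y K = +η k_{η+1}(x−y)`.
[cite: Takemura2017, Proposition 1.2] -/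
theorem hasDerivAt_eulerKernel_right (η : ℂ) {x y : ℝ} (hxy : y < x) :
    HasDerivAt (fun t : ℝ => eulerKernel η (x - t)) (η * eulerKernel (η + 1) (x - y)) y := by
  have h := (hasDerivAt_eulerKernel η (sub_pos.mpr hxy)).comp_const_sub x y
  have e : -(-η * eulerKernel (η + 1) (x - y)) = η * eulerKernel (η + 1) (x - y) := by ring
  rw [e] at h
  exact h

/-- **The kernel identity for `K(x,y) = (x−y)^{−η}`, `x > y`.** With `k = eulerKernel`,
`K = k_η(x−y)`, `∂_x K = −η k_{η+1}(x−y)`, `∂_x² K = η(η+1) k_{η+2}(x−y)` (and `∂_y K = −∂_x K`,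
`∂_y² K = ∂_x² K`): `lead(x) ∂_x²K + mid_{γδε}(x) ∂_xK + (αβx+q) K = M'†_y K` with the source
parameters of Takemura's Prop. 1.2, under the Fuchs relation and `(η−α)(η−β) = 0`.
[cite: Takemura2017, Proposition 1.2] -/
theorem euler_kernel_identity_pow {aH α β γ δ ε q η : ℂ} (hF : γ + δ + ε = α + β + 1)
    (hη : (η - α) * (η - β) = 0) {x y : ℝ} (hxy : y < x) :
    lead aH x * (η * (η + 1) * eulerKernel (η + 2) (x - y)) +
        mid aH γ δ ε x * (-η * eulerKernel (η + 1) (x - y)) +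
        low α β q x * eulerKernel η (x - y) =
      adjointApply aH (eulerSrcα η) (eulerSrcβ α β η) (eulerSrc γ η) (eulerSrc δ η)
        (eulerSrc ε η) (eulerSrcQ aH γ δ ε q η) y (eulerKernel η (x - y))
        (-(-η * eulerKernel (η + 1) (x - y))) (η * (η + 1) * eulerKernel (η + 2) (x - y)) := by
  have hpos : 0 < x - y := sub_pos.mpr hxy
  have h1 := mul_eulerKernel_succ η hpos
  have h2 := mul_eulerKernel_succ (η + 1) hpos
  have h2' : eulerKernel (η + 1 + 1) (x - y) = eulerKernel (η + 2) (x - y) := by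
    rw [show η + 1 + 1 = η + 2 by ring]
  rw [h2'] at h2
  push_cast at h1 h2
  refine euler_kernel_identity hF hη (ne_of_gt hxy) ?_ ?_
  · linear_combination (-η) * h1
  · linear_combination (η * (η + 1) * ((x : ℂ) - y)) * h2 + (η * (η + 1)) * h1

end GeneralHeun

end Literature.Analysis.ODE
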